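import Summits.BirchSwinnertonDyer.BirchSwinnertonDyer.Theorems.AlignedTransportAtTwoMainConjectureOfRankZeroBSDAtTwoSharedCubicPointFieldCM
import Literature.NumberTheory.IwasawaTheory.ClassicalMuVanishesTransportAlgEquivTwo
import Literature.NumberTheory.IwasawaTheory.CyclotomicTwoTotallyRamifiedEighthRoot
import Mathlib.FieldTheory.LinearDisjoint
import HarnessLib

/-!
# Route `AlignedTransportAtTwo`, crux C2 `MainConjectureOfRankZeroBSDAtTwo` (stmt-BirchSwinnertonDyer-22298):
# THE CM-SEXTIC CURRENCY — C2's `Δ > 0` atom (and, by att-p3 g34, the whole PFμ⁺ input, BOTH signs) read on an ABSTRACT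
# number field `F′ = F(√−1) ∋ e, i` (`[F′:ℚ] = 6`, `c_W(e) = 0`, `i² = −1`): `F′ ≃ₐ[ℚ] ℚ⟮x(T_j)⟯ ⊔ ℚ⟮i₀⟯`, `√2 ∉ F′`,
# `e_n(F′) = e_n(ℚ(β_j, √−1))`, and PFμ⁺'s conclusion for `W` ⟺ `μ₂(F′^cyc) = 0`

HONEST FRAMING. WIDTH-5 attached prover seat `bsd-line-att-p4` g32 on line `birth` of the lead `bsd-line-att-p2`; `--supports`
stmt-BirchSwinnertonDyer-22298, closes nothing; BSD is NOT proved; crux C2, its verdict «blocked-on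
`Rank1Residual.GreenbergMuConjectureIrreducible`» and every registered stub untouched. THEOREMS ONLY (no `def`, no named fact,
no `sorry`). Sequel of g31's `…SharedCubicDivisionField` (`ℚ⟮x(T_j)⟯ ≃ₐ[ℚ] F` for an abstract cubic `F ∋ e`) — g31's successor
item (b): the `Δ > 0` atom CM6M⁺ of the C2 input ledger (`μ₂ = 0` for the CM sextic `ℚ(β_j, √−1) ⊆ ℚ̄`, att-p3 g34) had no
abstract-field currency, because the transport lemma of the tree needed `2 ∤ [E:ℚ]`; g31's p782421 (`√2 ∉ E` instead) removes that.

WHAT (all for `W/ℚ` elliptic with no rational `2`-torsion abscissa; `F′` a number field with `[F′:ℚ] = 6` containing a root `e` of the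
`u`-cubic `c_W = u³ + b₂u² + 8b₄u + 16b₆` and an `i` with `i² = −1` — equivalently `F′ = F(√−1)` for a cubic `F ∋ e`, §3):
* §1 `finrank_adjoin_root_eq_three`, `finrank_adjoin_eq_two_of_sq_eq_neg_one`, `adjoin_root_sup_adjoin_eq_top` (`F′ = ℚ(e) ⊔ ℚ(i)`, degrees
  `3`, `2` coprime); ★ `nonempty_algEquiv_adjoin_sup_adjoin_of_mem_rootSet` / `nonempty_algEquiv_adjoin_xT_sup_adjoin_I` — **`F′ ≃ₐ[ℚ]
  ℚ⟮β⟯ ⊔ ℚ⟮i₀⟯`** for EVERY root `β` of the `2`-division cubic in `ℚ̄` and EVERY `i₀ ∈ ℚ̄` with `i₀² = −1` (embed `F′ ↪ ℚ̄` with `e ↦ 4β`;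
  the image of `i` is `±i₀`); `forall_sq_ne_two` (`√2 ∉ F′`: `ζ₈ ∉` a field of degree `6`, tree `sq_ne_two_of_sq_eq_neg_one_of_not_four_dvd_finrank`).
* §2 ★ `classNumberPExp_eq_pointFieldCM` (**`e_n(F′) = e_n(ℚ(β_j, √−1))`** for all `n`, any cyclotomic `ℤ₂`-towers), `forall_classicalMuVanishes_iff_pointFieldCM`
  (the CM6M⁺ input READ ON `F′`), `classicalLambda_eq_pointFieldCM`; ★★ `forall_classicalMuVanishes_sup_adjoin_I_iff_cmSextic` — **the conclusion
  of the registered stub PFμ⁺ (`μ₂ = 0` for `ℚ(W[2]) ⊔ ℚ⟮i₀⟯`) for `W` ⟺ `μ₂(F′^cyc) = 0`**, BOTH SIGNS of `Δ_W` (`Δ_W, ±2Δ_W ∉ ℚ²`; `…_of_isOrdinaryAt`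
  on the cruxes' binders) — att-p3 g34's `classicalMuVanishes_sup_adjoin_I_iff_pointFieldCM` composed with §1.
* §3 `finrank_eq_six_of_quadratic_over_cubic` / `forall_classicalMuVanishes_sup_adjoin_I_iff_cmSextic_over_cubic`: the same with `F′` presented as
  a quadratic extension `F′/F` of an abstract cubic field `F ∋ e` containing `i` (C1's binders + one square root).

READING (C2 input ledger; for -imc / next LEAD C2 / REF1 / REF2): the open Iwasawa input of road (b″) is, curve by curve and on both signs of
`Δ_W`, Iwasawa's `μ₂ = 0` for the cyclotomic `ℤ₂`-extension of the abstract CM sextic `F(√−1)`, `F` the cubic `2`-torsion field — no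
`ℚ̄`-model, no torsion point, no sign split. The sequel `…CMSexticFieldDoor` turns this into the crux BY NAME from ONE classical hypothesis.
Field theory + transport only; expected REF2 grade FOLKLORE / COROLLARY-OF-TREE. BSD is not proved by any of this.

References: [Washington1997] §13.1 (`ℚ_1 = ℚ(√2)`; the layers `E·ℚ_n`), Ch. 2 (`[ℚ(ζ₈):ℚ] = 4`); [Iwasawa1973MuInvariants] §1, §3;
[MilneFT2022] Ch. 3, Ch. 5 (stem fields, embeddings); [SilvermanAEC2009] III.§1, VIII.§1; tree: g31 `…SharedCubicDivisionField`,
`IwasawaTheory/ClassicalMuVanishesTransportAlgEquivTwo` (p782421), att-p3 g34 `…PointFieldCarrierCMIff`, bsd-2adic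
`IwasawaTheory/CyclotomicTwoTotallyRamifiedEighthRoot`, Mathlib `IntermediateField.LinearDisjoint.of_finrank_coprime`.
-/

-- the Theorems namespace of this sub repeats the summit name by design (D-0017 nested layout)
set_option linter.dupNamespace false
set_option autoImplicit false

noncomputable section

open scoped Classical NumberField IntermediateField

namespace Summit.BirchSwinnertonDyer.BirchSwinnertonDyer.Theorems.AlignedTransportAtTwoCMSexticCurrency

open NumberField Polynomial WeierstrassCurve IntermediateField Field
  Literature.NumberTheory.EllipticCurves Literature.NumberTheory.EllipticCurves.Greenberg1999
  Literature.NumberTheory.EllipticCurves.DokchitserDokchitser2012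
  Literature.NumberTheory.EllipticCurves.ZpExtension Literature.NumberTheory.GaloisRepresentations
  Literature.NumberTheory.IwasawaTheory Literature.NumberTheory.NumberFields
  Summit.BirchSwinnertonDyer.Rank1Residual.F1Sign2
  Summit.BirchSwinnertonDyer.BirchSwinnertonDyer.Theorems.AlignedTransportAtTwoFineRoad.DivisionCubic
  Summit.BirchSwinnertonDyer.BirchSwinnertonDyer.Theorems.AlignedTransportAtTwoSexticNormRelationDescentSignFree
  Summit.BirchSwinnertonDyer.BirchSwinnertonDyer.Theorems.AlignedTransportAtTwoSexticNormRelationDescentSignFreeAdjoinI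
  Summit.BirchSwinnertonDyer.BirchSwinnertonDyer.Theorems.AlignedTransportAtTwoPointFieldCarrierCMIff
  Summit.BirchSwinnertonDyer.BirchSwinnertonDyer.Theorems.AlignedTransportAtTwoSharedCubicDivisionField

/-! ## §0 Two elementary field-theory facts -/

/-- **`[ℚ(i) : ℚ] = 2` for `i² = −1` in ANY field of characteristic `0`** (`i` is a primitive `4`-th root of unity, minimal polynomial `Φ₄`).
[cite: Washington1997, Ch. 2 (`[ℚ(ζ_n):ℚ] = φ(n)`)] -/
theorem finrank_adjoin_eq_two_of_sq_eq_neg_one {L : Type*} [Field L] [CharZero L] {x : L} (hx : x ^ 2 = -1) :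
    Module.finrank ℚ ↥ℚ⟮x⟯ = 2 := by
  have h4 : IsPrimitiveRoot x 4 := by
    refine IsPrimitiveRoot.mk_of_lt x (by norm_num) (by rw [show (4 : ℕ) = 2 * 2 by rfl, pow_mul, hx]; norm_num) ?_
    intro k hk hk4
    interval_cases k
    · rw [pow_one]; intro h1; rw [h1] at hx; norm_num at hx
    · rw [hx]; norm_num
    · rw [show (3 : ℕ) = 2 + 1 by rfl, pow_succ, hx]
      intro h; have : x = -1 := by linear_combination -h
      rw [this] at hx; norm_num at hx
  have hint : IsIntegral ℚ x := ⟨X ^ 2 + 1, monic_X_pow_add_C _ two_ne_zero, by simp [hx]⟩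
  rw [adjoin.finrank hint, ← Polynomial.cyclotomic_eq_minpoly_rat h4 (by norm_num), Polynomial.natDegree_cyclotomic]
  decide

/-- In `ℚ̄` two square roots of `−1` generate the same field (`y = ±x`). [folklore] -/
theorem adjoin_eq_adjoin_of_sq_eq_neg_one {x y : AlgebraicClosure ℚ} (hx : x ^ 2 = -1) (hy : y ^ 2 = -1) :
    (ℚ⟮x⟯ : IntermediateField ℚ (AlgebraicClosure ℚ)) = ℚ⟮y⟯ := by
  have hprod : (x - y) * (x + y) = 0 := by linear_combination hx - hy
  rcases mul_eq_zero.mp hprod with h | h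
  · rw [sub_eq_zero.mp h]
  · have hxy : x = -y := add_eq_zero_iff_eq_neg.mp h
    refine le_antisymm (adjoin_simple_le_iff.mpr ?_) (adjoin_simple_le_iff.mpr ?_)
    · rw [hxy]; exact neg_mem (mem_adjoin_simple_self ℚ y)
    · rw [show y = -x by rw [hxy, neg_neg]]; exact neg_mem (mem_adjoin_simple_self ℚ x)

/-- `ℚ⟮q·z⟯ = ℚ⟮z⟯` in `ℚ̄` for a non-zero rational `q`. [folklore] -/
theorem adjoin_ratCast_mul_eq (q : ℚ) (hq : q ≠ 0) (z : AlgebraicClosure ℚ) :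
    (ℚ⟮(q : AlgebraicClosure ℚ) * z⟯ : IntermediateField ℚ (AlgebraicClosure ℚ)) = ℚ⟮z⟯ := by
  have hq' : (q : AlgebraicClosure ℚ) ≠ 0 := by exact_mod_cast hq
  have hqmem : ∀ K : IntermediateField ℚ (AlgebraicClosure ℚ), (q : AlgebraicClosure ℚ) ∈ K := fun K ↦ by
    exact_mod_cast K.algebraMap_mem q
  refine le_antisymm (adjoin_simple_le_iff.mpr ?_) (adjoin_simple_le_iff.mpr ?_)
  · exact mul_mem (hqmem _) (mem_adjoin_simple_self ℚ z)
  · have hmem : (q : AlgebraicClosure ℚ)⁻¹ * ((q : AlgebraicClosure ℚ) * z) ∈ ℚ⟮(q : AlgebraicClosure ℚ) * z⟯ :=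
      mul_mem (inv_mem (hqmem _)) (mem_adjoin_simple_self ℚ _)
    rwa [← mul_assoc, inv_mul_cancel₀ hq', one_mul] at hmem

/-! ## §1 An abstract CM sextic `F′ ∋ e, i` and its models `ℚ⟮β⟯ ⊔ ℚ⟮i₀⟯ ⊆ ℚ̄` -/

section Abstract

variable (W : WeierstrassCurve ℚ) [W.IsElliptic] (ht : ∀ x : ℚ, ¬ HasRationalTwoTorsionX W x)
  {F' : Type} [Field F'] [NumberField F'] (hF' : Module.finrank ℚ F' = 6)
  {e i : F'} (he : aeval e (twoDivisionUCubic W) = 0) (hi : i ^ 2 = -1)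

include ht he in
/-- `[ℚ(e) : ℚ] = 3` for a root `e` of the `u`-cubic `c_W` in any number field (`E(ℚ)[2] = 0`: `c_W` is irreducible, g31).
[cite: SilvermanAEC2009, III.2.3] [cite: MilneFT2022, Ch. 3] -/
theorem finrank_adjoin_root_eq_three : Module.finrank ℚ ↥ℚ⟮e⟯ = 3 := by
  rw [adjoin.finrank (IsIntegral.of_finite ℚ e), minpoly_eq_twoDivisionUCubic' W ht he, (monic_twoDivisionUCubic_and_natDegree W).2]

include ht hF' he hi in
/-- **`F′ = ℚ(e) ⊔ ℚ(i)`**: the cubic `ℚ(e)` and the quadratic `ℚ(i)` have coprime degrees, so they are linearly disjoint and their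
compositum has degree `6 = [F′:ℚ]`. [cite: MilneFT2022, Ch. 3 (degrees of composita)] -/
theorem adjoin_root_sup_adjoin_eq_top : (ℚ⟮e⟯ ⊔ ℚ⟮i⟯ : IntermediateField ℚ F') = ⊤ := by
  have h3 := finrank_adjoin_root_eq_three W ht he
  have h2 := finrank_adjoin_eq_two_of_sq_eq_neg_one hi
  have hcop : (Module.finrank ℚ ↥ℚ⟮e⟯).Coprime (Module.finrank ℚ ↥(ℚ⟮i⟯ : IntermediateField ℚ F')) := by
    rw [h3, h2]; decide
  have h6 : Module.finrank ℚ ↥(ℚ⟮e⟯ ⊔ ℚ⟮i⟯ : IntermediateField ℚ F') = 6 := by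
    rw [(IntermediateField.LinearDisjoint.of_finrank_coprime hcop).finrank_sup, h3, h2]
  exact IntermediateField.eq_of_le_of_finrank_eq le_top (by rw [h6, finrank_top', hF'])

include ht hF' he hi in
/-- ★ **`F′ ≃ₐ[ℚ] ℚ⟮β⟯ ⊔ ℚ⟮i₀⟯` for EVERY root `β` of the `2`-division cubic of `W` in `ℚ̄` and EVERY `i₀ ∈ ℚ̄` with `i₀² = −1`.**
Embed `F′ ↪ ℚ̄` with `e ↦ 4β` (the conjugates of `e` are the `4z`, `z` a root — g31 `mem_rootSet_twoTorsionPolynomial_iff_exists_algHom`); the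
image of `i` is `±i₀`; the image of `F′ = ℚ(e) ⊔ ℚ(i)` is `ℚ⟮4β⟯ ⊔ ℚ⟮±i₀⟯ = ℚ⟮β⟯ ⊔ ℚ⟮i₀⟯`. [cite: MilneFT2022, Ch. 3 and Ch. 5] [cite: SilvermanAEC2009, VIII.§1] -/
theorem nonempty_algEquiv_adjoin_sup_adjoin_of_mem_rootSet {β : AlgebraicClosure ℚ}
    (hβ : β ∈ W.twoTorsionPolynomial.toPoly.rootSet (AlgebraicClosure ℚ)) {i₀ : AlgebraicClosure ℚ} (hi₀ : i₀ ^ 2 = -1) :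
    Nonempty (F' ≃ₐ[ℚ] ↥(ℚ⟮β⟯ ⊔ ℚ⟮i₀⟯ : IntermediateField ℚ (AlgebraicClosure ℚ))) := by
  obtain ⟨ψ, hψ⟩ := (mem_rootSet_twoTorsionPolynomial_iff_exists_algHom W ht he β).mp hβ
  have hψi : (ψ i) ^ 2 = -1 := by rw [← map_pow, hi, map_neg, map_one]
  -- the images of the two generators generate the model
  have h4β : (ℚ⟮ψ e⟯ : IntermediateField ℚ (AlgebraicClosure ℚ)) = ℚ⟮β⟯ := by
    rw [hψ, show (4 : AlgebraicClosure ℚ) * β = ((4 : ℚ) : AlgebraicClosure ℚ) * β by norm_num]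
    exact adjoin_ratCast_mul_eq 4 (by norm_num) β
  have hiψ : (ℚ⟮ψ i⟯ : IntermediateField ℚ (AlgebraicClosure ℚ)) = ℚ⟮i₀⟯ := adjoin_eq_adjoin_of_sq_eq_neg_one hψi hi₀
  have hrange : IntermediateField.map ψ ⊤ = ℚ⟮β⟯ ⊔ ℚ⟮i₀⟯ := by
    rw [← adjoin_root_sup_adjoin_eq_top W ht hF' he hi, IntermediateField.map_sup, adjoin_map, adjoin_map,
      Set.image_singleton, Set.image_singleton, h4β, hiψ]
  exact ⟨(topEquiv.symm.trans (equivMap ⊤ ψ)).trans (equivOfEq hrange)⟩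

include ht hF' he hi in
/-- ★ **`F′ ≃ₐ[ℚ] ℚ⟮x(T_j)⟯ ⊔ ℚ⟮i₀⟯`** for every `j` and every `i₀² = −1` — the abstract CM sextic is isomorphic to each of the three models of
the CM point field `ℚ(β_j, √−1)` used by the C2 ledger (att-p3 g34, att-p4 g31). [cite: MilneFT2022, Ch. 3 and Ch. 5] [cite: SilvermanAEC2009, VIII.§1] -/
theorem nonempty_algEquiv_adjoin_xT_sup_adjoin_I (j : Fin 3) {i₀ : AlgebraicClosure ℚ} (hi₀ : i₀ ^ 2 = -1) :
    Nonempty (F' ≃ₐ[ℚ] ↥(ℚ⟮xT W two_ne_zero j⟯ ⊔ IntermediateField.adjoin ℚ ({i₀} : Set (AlgebraicClosure ℚ)))) :=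
  nonempty_algEquiv_adjoin_sup_adjoin_of_mem_rootSet W ht hF' he hi (xT_mem_rootSet W two_ne_zero j) hi₀

include hF' hi in
/-- **`√2 ∉ F′`**: a field of degree `6` containing `√−1` contains no `√2` (else it contains `ζ₈ = (1+i)/√2`, of degree `4 ∤ 6`; cell bsd-2adic's
`sq_ne_two_of_sq_eq_neg_one_of_not_four_dvd_finrank`). So the cyclotomic `ℤ₂`-extension of `F′` is the restriction of that of `ℚ`.
[cite: Washington1997, §13.1 and Ch. 2] -/
theorem forall_sq_ne_two : ∀ s : F', s ^ 2 ≠ 2 :=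
  sq_ne_two_of_sq_eq_neg_one_of_not_four_dvd_finrank hi (by rw [hF']; decide)

/-! ## §2 The CM point-field input read on `F′` -/

include ht hF' he hi in
/-- ★ **`e_n(F′) = e_n(ℚ(β_j, √−1))` for every `n`** (any cyclotomic `ℤ₂`-extensions of `F′` and of the model `ℚ⟮x(T_j)⟯ ⊔ ℚ⟮i₀⟯ ⊆ ℚ̄`, any
`j`, any `i₀² = −1`): transport along §1's `ℚ`-isomorphism, legitimate in even degree because `√2 ∉ F′` (g31 p782421). [cite: Washington1997, §13.1] -/
theorem classNumberPExp_eq_pointFieldCM (j : Fin 3) {i₀ : AlgebraicClosure ℚ} (hi₀ : i₀ ^ 2 = -1)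
    (κF : ZpExtension F' 2) (hκF : κF.IsCyclotomic)
    (κP : ZpExtension ↥(ℚ⟮xT W two_ne_zero j⟯ ⊔ IntermediateField.adjoin ℚ ({i₀} : Set (AlgebraicClosure ℚ))) 2)
    (hκP : κP.IsCyclotomic) (n : ℕ) :
    classNumberPExp κF n = classNumberPExp κP n := by
  haveI : FiniteDimensional ℚ ↥(IntermediateField.adjoin ℚ ({i₀} : Set (AlgebraicClosure ℚ))) :=
    adjoin.finiteDimensional ⟨X ^ 2 + 1, monic_X_pow_add_C _ two_ne_zero, by simp [hi₀]⟩
  haveI : FiniteDimensional ℚ ↥ℚ⟮xT W two_ne_zero j⟯ :=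
    adjoin.finiteDimensional ((AlgebraicClosure.isAlgebraic ℚ).isAlgebraic _).isIntegral
  haveI : FiniteDimensional ℚ ↥(ℚ⟮xT W two_ne_zero j⟯ ⊔ IntermediateField.adjoin ℚ ({i₀} : Set (AlgebraicClosure ℚ))) :=
    IntermediateField.finiteDimensional_sup _ _
  haveI : NumberField ↥(ℚ⟮xT W two_ne_zero j⟯ ⊔ IntermediateField.adjoin ℚ ({i₀} : Set (AlgebraicClosure ℚ))) :=
    NumberField.of_module_finite ℚ _
  obtain ⟨φ⟩ := nonempty_algEquiv_adjoin_xT_sup_adjoin_I W ht hF' he hi j hi₀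
  exact classNumberPExp_eq_of_algEquiv_of_forall_sq_ne_two φ (forall_sq_ne_two hF' hi) κF hκF κP hκP n

include ht hF' he hi in
/-- ★ **CM6M⁺ READ ON `F′`: `μ₂ = 0` (growth form) for the cyclotomic `ℤ₂`-extensions of `F′` iff for those of `ℚ(β_j, √−1)`** (any `j`, any
`i₀² = −1`). [cite: Washington1997, §13.1] [cite: RaySujatha2021, §1 eq. (1.1)] -/
theorem forall_classicalMuVanishes_iff_pointFieldCM (j : Fin 3) {i₀ : AlgebraicClosure ℚ} (hi₀ : i₀ ^ 2 = -1) :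
    (∀ κF : ZpExtension F' 2, κF.IsCyclotomic → ClassicalMuVanishes κF) ↔
      ∀ κP : ZpExtension ↥(ℚ⟮xT W two_ne_zero j⟯ ⊔ IntermediateField.adjoin ℚ ({i₀} : Set (AlgebraicClosure ℚ))) 2,
        κP.IsCyclotomic → ClassicalMuVanishes κP := by
  haveI : FiniteDimensional ℚ ↥(IntermediateField.adjoin ℚ ({i₀} : Set (AlgebraicClosure ℚ))) :=
    adjoin.finiteDimensional ⟨X ^ 2 + 1, monic_X_pow_add_C _ two_ne_zero, by simp [hi₀]⟩
  haveI : FiniteDimensional ℚ ↥ℚ⟮xT W two_ne_zero j⟯ :=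
    adjoin.finiteDimensional ((AlgebraicClosure.isAlgebraic ℚ).isAlgebraic _).isIntegral
  haveI : FiniteDimensional ℚ ↥(ℚ⟮xT W two_ne_zero j⟯ ⊔ IntermediateField.adjoin ℚ ({i₀} : Set (AlgebraicClosure ℚ))) :=
    IntermediateField.finiteDimensional_sup _ _
  haveI : NumberField ↥(ℚ⟮xT W two_ne_zero j⟯ ⊔ IntermediateField.adjoin ℚ ({i₀} : Set (AlgebraicClosure ℚ))) :=
    NumberField.of_module_finite ℚ _
  obtain ⟨φ⟩ := nonempty_algEquiv_adjoin_xT_sup_adjoin_I W ht hF' he hi j hi₀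
  exact forall_classicalMuVanishes_iff_of_algEquiv_of_forall_sq_ne_two φ (forall_sq_ne_two hF' hi)

include ht hF' he hi in
/-- **`λ₂(F′) = λ₂(ℚ(β_j, √−1))`** (the tree's growth-form `classicalLambda`; any cyclotomic `ℤ₂`-extensions, any `j`, any `i₀² = −1`).
[cite: Washington1997, §13.3 Thm. 13.13] -/
theorem classicalLambda_eq_pointFieldCM (j : Fin 3) {i₀ : AlgebraicClosure ℚ} (hi₀ : i₀ ^ 2 = -1)
    (κF : ZpExtension F' 2) (hκF : κF.IsCyclotomic)
    (κP : ZpExtension ↥(ℚ⟮xT W two_ne_zero j⟯ ⊔ IntermediateField.adjoin ℚ ({i₀} : Set (AlgebraicClosure ℚ))) 2)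
    (hκP : κP.IsCyclotomic) :
    classicalLambda κF = classicalLambda κP := by
  haveI : FiniteDimensional ℚ ↥(IntermediateField.adjoin ℚ ({i₀} : Set (AlgebraicClosure ℚ))) :=
    adjoin.finiteDimensional ⟨X ^ 2 + 1, monic_X_pow_add_C _ two_ne_zero, by simp [hi₀]⟩
  haveI : FiniteDimensional ℚ ↥ℚ⟮xT W two_ne_zero j⟯ :=
    adjoin.finiteDimensional ((AlgebraicClosure.isAlgebraic ℚ).isAlgebraic _).isIntegral
  haveI : FiniteDimensional ℚ ↥(ℚ⟮xT W two_ne_zero j⟯ ⊔ IntermediateField.adjoin ℚ ({i₀} : Set (AlgebraicClosure ℚ))) :=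
    IntermediateField.finiteDimensional_sup _ _
  haveI : NumberField ↥(ℚ⟮xT W two_ne_zero j⟯ ⊔ IntermediateField.adjoin ℚ ({i₀} : Set (AlgebraicClosure ℚ))) :=
    NumberField.of_module_finite ℚ _
  obtain ⟨φ⟩ := nonempty_algEquiv_adjoin_xT_sup_adjoin_I W ht hF' he hi j hi₀
  exact classicalLambda_eq_of_algEquiv_of_forall_sq_ne_two φ (forall_sq_ne_two hF' hi) κF hκF κP hκP

include ht hF' he hi in
/-- ★★ **PFμ⁺'s conclusion for `W` ⟺ `μ₂(F′^cyc) = 0`, BOTH SIGNS of `Δ_W`.** For `W` with no rational `2`-torsion abscissa and `Δ_W, 2Δ_W, −2Δ_W ∉ ℚ²`,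
and `i₀ ∈ ℚ̄` with `i₀² = −1`: «`μ₂ = 0` for every cyclotomic `ℤ₂`-extension of the registered carrier `ℚ(W[2]) ⊔ ℚ⟮i₀⟯`» holds iff «`μ₂ = 0` for every
cyclotomic `ℤ₂`-extension of the abstract CM sextic `F′`» (att-p3 g34's `classicalMuVanishes_sup_adjoin_I_iff_pointFieldCM` + §2).
[cite: Iwasawa1973MuInvariants, Thm. 2 and Thm. 3, §3] [cite: Washington1997, §13.1 and §13.3 Prop. 13.23] -/
theorem forall_classicalMuVanishes_sup_adjoin_I_iff_cmSextic (hsq : ¬ IsSquare W.Δ) (h2Δ : ¬ IsSquare (2 * W.Δ))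
    (hm2Δ : ¬ IsSquare (-2 * W.Δ)) {i₀ : AlgebraicClosure ℚ} (hi₀ : i₀ ^ 2 = -1) :
    (∀ κL : ZpExtension ↥(W.divisionField 2 ⊔ IntermediateField.adjoin ℚ ({i₀} : Set (AlgebraicClosure ℚ))) 2,
        κL.IsCyclotomic → ClassicalMuVanishes κL) ↔
      ∀ κF : ZpExtension F' 2, κF.IsCyclotomic → ClassicalMuVanishes κF := by
  rw [classicalMuVanishes_sup_adjoin_I_iff_pointFieldCM W ht hsq h2Δ hm2Δ hi₀ 0,
    forall_classicalMuVanishes_iff_pointFieldCM W ht hF' he hi 0 hi₀]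

include ht hF' he hi in
/-- ★★ **On the cruxes' binders** (`W` globally minimal, good ordinary at `2`, no rational `2`-torsion abscissa, `Δ_W ∉ ℚ²`; `±2Δ_W ∉ ℚ²` automatic):
PFμ⁺'s conclusion for `W` and `i₀` ⟺ `μ₂ = 0` for every cyclotomic `ℤ₂`-extension of the abstract CM sextic `F′ ∋ e, i`, BOTH SIGNS.
[cite: Iwasawa1973MuInvariants, Thm. 2 and Thm. 3, §3] [cite: SilvermanAEC2009, VII.5 Prop. 5.1(a)] -/
theorem forall_classicalMuVanishes_sup_adjoin_I_iff_cmSextic_of_isOrdinaryAt [W.IsGloballyMinimal] (hord : IsOrdinaryAt W 2)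
    (hsq : ¬ IsSquare W.Δ) {i₀ : AlgebraicClosure ℚ} (hi₀ : i₀ ^ 2 = -1) :
    (∀ κL : ZpExtension ↥(W.divisionField 2 ⊔ IntermediateField.adjoin ℚ ({i₀} : Set (AlgebraicClosure ℚ))) 2,
        κL.IsCyclotomic → ClassicalMuVanishes κL) ↔
      ∀ κF : ZpExtension F' 2, κF.IsCyclotomic → ClassicalMuVanishes κF :=
  forall_classicalMuVanishes_sup_adjoin_I_iff_cmSextic W ht hF' he hi hsq (not_isSquare_two_mul_Δ_of_isOrdinaryAt W hord)
    (not_isSquare_neg_two_mul_Δ_of_isOrdinaryAt W hord) hi₀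

end Abstract

/-! ## §3 `F′` presented as `F(√−1)` over an abstract cubic field `F ∋ e` (C1's binders + one square root) -/

section OverCubic

variable (W : WeierstrassCurve ℚ) [W.IsElliptic] (ht : ∀ x : ℚ, ¬ HasRationalTwoTorsionX W x)
  {F : Type} [Field F] [NumberField F] (hF : Module.finrank ℚ F = 3) {e : F} (he : aeval e (twoDivisionUCubic W) = 0)
  {F' : Type} [Field F'] [NumberField F'] [Algebra F F'] (hFF' : Module.finrank F F' = 2) {i : F'} (hi : i ^ 2 = -1)

include hF hFF' in
/-- `[F′ : ℚ] = 6` for a quadratic extension `F′` of a cubic number field `F` (tower law). [cite: MilneFT2022, Ch. 1 (multiplicativity of degrees)] -/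
theorem finrank_eq_six_of_quadratic_over_cubic : Module.finrank ℚ F' = 6 := by
  rw [← Module.finrank_mul_finrank ℚ F F', hF, hFF']

omit [W.IsElliptic] in
include he in
/-- The image of `e` in `F′` is a root of `c_W`. [folklore] -/
theorem aeval_algebraMap_twoDivisionUCubic : aeval (algebraMap F F' e) (twoDivisionUCubic W) = 0 := by
  rw [aeval_algebraMap_apply, he, map_zero]

include ht hF he hFF' hi in
/-- ★★ **PFμ⁺'s conclusion for `W` ⟺ `μ₂(F(√−1)^cyc) = 0`** with `F′ = F(√−1)` presented over an abstract cubic field `F ∋ e` (`[F:ℚ] = 3`, `c_W(e) = 0`,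
`[F′:F] = 2`, `i ∈ F′`, `i² = −1`) — C1's currency; `W` with no rational `2`-torsion abscissa and `Δ_W, ±2Δ_W ∉ ℚ²`, `i₀² = −1`, BOTH SIGNS.
[cite: Iwasawa1973MuInvariants, Thm. 2 and Thm. 3, §3] [cite: Washington1997, §13.1] -/
theorem forall_classicalMuVanishes_sup_adjoin_I_iff_cmSextic_over_cubic (hsq : ¬ IsSquare W.Δ) (h2Δ : ¬ IsSquare (2 * W.Δ))
    (hm2Δ : ¬ IsSquare (-2 * W.Δ)) {i₀ : AlgebraicClosure ℚ} (hi₀ : i₀ ^ 2 = -1) :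
    (∀ κL : ZpExtension ↥(W.divisionField 2 ⊔ IntermediateField.adjoin ℚ ({i₀} : Set (AlgebraicClosure ℚ))) 2,
        κL.IsCyclotomic → ClassicalMuVanishes κL) ↔
      ∀ κF : ZpExtension F' 2, κF.IsCyclotomic → ClassicalMuVanishes κF :=
  forall_classicalMuVanishes_sup_adjoin_I_iff_cmSextic W ht (finrank_eq_six_of_quadratic_over_cubic hF hFF')
    (aeval_algebraMap_twoDivisionUCubic W he) hi hsq h2Δ hm2Δ hi₀

include ht hF he hFF' hi in
/-- **The same on the cruxes' binders** (`W` globally minimal, good ordinary at `2`, no rational `2`-torsion abscissa, `Δ_W ∉ ℚ²`).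
[cite: Iwasawa1973MuInvariants, Thm. 2 and Thm. 3, §3] [cite: SilvermanAEC2009, VII.5 Prop. 5.1(a)] -/
theorem forall_classicalMuVanishes_sup_adjoin_I_iff_cmSextic_over_cubic_of_isOrdinaryAt [W.IsGloballyMinimal] (hord : IsOrdinaryAt W 2)
    (hsq : ¬ IsSquare W.Δ) {i₀ : AlgebraicClosure ℚ} (hi₀ : i₀ ^ 2 = -1) :
    (∀ κL : ZpExtension ↥(W.divisionField 2 ⊔ IntermediateField.adjoin ℚ ({i₀} : Set (AlgebraicClosure ℚ))) 2,
        κL.IsCyclotomic → ClassicalMuVanishes κL) ↔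
      ∀ κF : ZpExtension F' 2, κF.IsCyclotomic → ClassicalMuVanishes κF :=
  forall_classicalMuVanishes_sup_adjoin_I_iff_cmSextic_of_isOrdinaryAt W ht (finrank_eq_six_of_quadratic_over_cubic hF hFF')
    (aeval_algebraMap_twoDivisionUCubic W he) hi hord hsq hi₀

end OverCubic

end Summit.BirchSwinnertonDyer.BirchSwinnertonDyer.Theorems.AlignedTransportAtTwoCMSexticCurrency

end
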